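import Mathlib.Topology.Algebra.Category.ProfiniteGrp.Basic
import Mathlib.Topology.Algebra.Group.ClosedSubgroup
import Mathlib.Algebra.Group.Subgroup.Pointwise
import Mathlib.NumberTheory.NumberField.Basic
import Mathlib.NumberTheory.Padics.PadicNumbers
import Mathlib.Analysis.Complex.Basic
import Literature.NumberTheory.GaloisRepresentations.AbsGaloisGroup
import HarnessLib

/-!
# The arithmetic fundamental extension `1 → Δ → Π → G → 1` (interface)

This file is the INTERFACE over which the absolute anabelian statements of Mochizuki's
*Topics in Absolute Anabelian Geometry I–III* ([AbsTopI–III]) and their uses in [EtTh], [SemiAnbd]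
and [IUTchI–III] are typed.  The input datum of every "group-theoretic reconstruction algorithm" of
[AbsTopIII] §1 is an *extension of profinite groups*
`1 → Δ_X → Π_X → G_k → 1`, "where `Π_X := π₁(X) → G_k := Gal(k̄/k)` denotes the natural surjection
of étale fundamental groups [...], and `Δ_X` denotes the kernel of this surjection"
([AbsTopIII] Thm 1.9 p. 37, Cor 1.10 p. 41, Thm 1.11 p. 45; the same display is [IUTchI]
Def 3.1 (b)).  Page locators `p. N` for [AbsTopIII] are the PDF pages of the author's manuscript
(lit key `paper:url-5493eb38cbb7`, 164 pp.), for [AbsTopI] those of `paper:url-11ac98ba15fc`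
(83 pp.); the journal paginations are not held.

## Contents

* `FundamentalExtension`: DATA `arith gal : ProfiniteGrp` ("`Π`", "`G`") and a continuous
  surjection `aug : arith →ₜ* gal`; the geometric group `geom = Δ := ker aug` is DERIVED (closed,
  normal; `geomGrp` is `Δ` as a profinite group).  Pure topological group theory: no scheme, no
  étale `π₁` is constructed here (the statement "this extension arises from a hyperbolic orbicurve
  over `k`" is a hypothesis structure of the files that need it).
* the category structure on `FundamentalExtension` (morphisms = pairs of continuous homomorphisms
  forming a commutative square with the augmentations), the induced map on `Δ`, and the two
  classes of morphisms with respect to which [AbsTopIII] asserts functoriality: *open injective*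
  homomorphisms of extensions (Thm 1.9, final paragraph, p. 38) and homomorphisms *arising from a
  base-change of the base field* (loc. cit.), the latter typed as "bijective on `Δ`".
* `CuspidalData E`: decomposition groups `D_x ⊆ Π` and inertia groups `I_x = D_x ∩ Δ` of cusps,
  at the level of chosen representatives of conjugacy classes ([AbsTopIII] Prop 1.4 (i) p. 31,
  Thm 1.9 (a) p. 37, Thm 1.11 (b) p. 46); `IsFreeProcyclic` ("`≅ Ẑ`").
* the field types NF / MLF / FF of [AbsTopI] §0 p. 7 and CAF / RAF of [AbsTopIII] §0 p. 25 as
  predicates on a (topological) field; `absoluteGaloisGrp k`, the absolute Galois group of a field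
  of characteristic zero as an object of `ProfiniteGrp` (the `gal` of every geometric instance).

## Deliberately NOT here

* "slim", "commensurably terminal", `Z_G`, `N_G`, `C_G` ([AbsTopI] §0 pp. 7–8): Mathlib
  `Subgroup.centralizer` / `Subgroup.normalizer` / `Commensurable.commensurator` and the tree's
  `Literature.AlgebraicGeometry.Frobenioids.IsSlimGroup` ([FrdI] §0 p. 13, same definition).
* any assertion that a given extension arises from geometry; the Galois-module structure `Ẑ(1)`
  of inertia groups (it enters through the cyclotomes of [AbsTopIII] Prop 1.4 (ii), Cor 1.10).
-/

open CategoryTheory Topology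
open scoped Pointwise

universe u

namespace Literature.AnabelianGeometry.AbsoluteAnabelian

/-! ### Field types ([AbsTopI] §0 "Numbers" p. 7; [AbsTopIII] §0 "Numbers" p. 25) -/

section FieldTypes

/-- "A finite field extension of `ℚ` will be referred to as a *number field*, or NF, for short"
([AbsTopI] §0 p. 7) — a one-field wrapper of Mathlib's `NumberField` (use `isNF_iff`).
[cite: MochizukiAbsTopI2012, §0 p.7] -/
@[mk_iff] structure IsNF (K : Type u) [Field K] : Prop where
  /-- `K` is a number field in Mathlib's sense -/
  numberField : NumberField K

/-- "A finite field extension of `ℚ_p` for some `p ∈ Primes` will be referred to as a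
*mixed-characteristic nonarchimedean local field*, or MLF, for short" ([AbsTopI] §0 p. 7), as a
property of the bare field `K`: some `ℚ_p` maps to `K` making `K` a finite `ℚ_p`-module.
[cite: MochizukiAbsTopI2012, §0 p.7] -/
@[mk_iff] structure IsMLF (K : Type u) [Field K] : Prop where
  /-- there are a prime `p` and a ring homomorphism `ℚ_p → K` of finite degree -/
  exists_padic : ∃ (p : ℕ) (_ : Fact p.Prime) (f : ℚ_[p] →+* K),
    @Module.Finite ℚ_[p] K _ _ f.toAlgebra.toModule

/-- "A field of finite cardinality will be referred to as a *finite field*, or FF, for short"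
([AbsTopI] §0 p. 7) — a one-field wrapper of `Finite K` (use `isFF_iff`).
[cite: MochizukiAbsTopI2012, §0 p.7] -/
@[mk_iff] structure IsFF (K : Type u) [Field K] : Prop where
  /-- `K` has finitely many elements -/
  finite : Finite K

/-- "A(n) *complex archimedean field* [...], or CAF [...], is defined to be a topological field
that is isomorphic to the field of complex numbers" ([AbsTopIII] §0 p. 25): there is a ring
isomorphism `K ≃+* ℂ` that is a homeomorphism. [cite: MochizukiAbsTopIII2015, §0 p.25] -/
@[mk_iff] structure IsCAF (K : Type u) [Field K] [TopologicalSpace K] : Prop where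
  /-- a bicontinuous field isomorphism with `ℂ` -/
  exists_equiv : ∃ e : K ≃+* ℂ, Continuous e ∧ Continuous e.symm

/-- A *real archimedean field*, or RAF: "a topological field that is isomorphic to the field of
real numbers" ([AbsTopIII] §0 p. 25). [cite: MochizukiAbsTopIII2015, §0 p.25] -/
@[mk_iff] structure IsRAF (K : Type u) [Field K] [TopologicalSpace K] : Prop where
  /-- a bicontinuous field isomorphism with `ℝ` -/
  exists_equiv : ∃ e : K ≃+* ℝ, Continuous e ∧ Continuous e.symm

/-- An *archimedean field*, or AF: a topological field isomorphic to "either the field of real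
numbers or the field of complex numbers" ([AbsTopIII] §0 p. 25).
[cite: MochizukiAbsTopIII2015, §0 p.25] -/
@[mk_iff] structure IsAF (K : Type u) [Field K] [TopologicalSpace K] : Prop where
  /-- `K` is an RAF or a CAF -/
  raf_or_caf : IsRAF K ∨ IsCAF K

end FieldTypes

/-! ### The absolute Galois group as a profinite group -/

/-- `G_k := Gal(k̄/k)` for a field `k` of characteristic zero, as an object of `ProfiniteGrp`
(compact, Hausdorff, totally disconnected for the Krull topology: the tree's instances on
Mathlib's `Field.absoluteGaloisGroup`).  This is the `gal` of every extension "arising from" a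
curve over `k` ([AbsTopIII] Thm 1.9 p. 37: "`G_k := Gal(k̄/k)`").
[cite: MochizukiAbsTopIII2015, Thm 1.9 p.37] -/
noncomputable abbrev absoluteGaloisGrp (k : Type u) [Field k] [CharZero k] : ProfiniteGrp.{u} :=
  ProfiniteGrp.of (Field.absoluteGaloisGroup k)

/-! ### The extension `1 → Δ → Π → G → 1` -/

/-- An *extension of profinite groups* `1 → Δ → Π → G → 1` in the sense of [AbsTopIII] Thm 1.9
p. 37 / Cor 1.10 p. 41 / Thm 1.11 p. 45 ("`Π_X := π₁(X) → G_k` [...] the natural surjection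
[...], and `Δ_X` denotes the kernel of this surjection — the resulting extension of profinite
groups"): the DATA are the profinite groups `arith` ("`Π`") and `gal` ("`G`") and the continuous
surjection `aug`; `Δ` is derived as `geom := ker aug`.  Same display: [IUTchI] Def 3.1 (b).
[cite: MochizukiAbsTopIII2015, Thm 1.9 p.37] -/
structure FundamentalExtension : Type (u + 1) where
  /-- the arithmetic fundamental group `Π` -/
  arith : ProfiniteGrp.{u}
  /-- the Galois group `G` of the base field -/
  gal : ProfiniteGrp.{u}
  /-- the augmentation `Π ↠ G` -/
  aug : arith →ₜ* gal
  /-- the augmentation is surjective -/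
  aug_surjective : Function.Surjective aug

namespace FundamentalExtension

variable (E : FundamentalExtension.{u})

/-- The geometric fundamental group `Δ := Ker(Π ↠ G)` as a subgroup of `Π` ([AbsTopIII] Thm 1.9
p. 37 "`Δ_X` denotes the kernel of this surjection"). [cite: MochizukiAbsTopIII2015, Thm 1.9 p.37] -/
def geom : Subgroup E.arith := E.aug.toMonoidHom.ker

/-- `Δ = Ker(aug)` (definitional). [cite: MochizukiAbsTopIII2015, Thm 1.9 p.37] -/
theorem geom_eq_ker : E.geom = E.aug.toMonoidHom.ker := rfl

/-- `Ker(aug) = Δ` (the orientation used by the tempered interface of [SemiAnbd]).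
[cite: MochizukiAbsTopIII2015, Thm 1.9 p.37] -/
theorem ker_aug : E.aug.toMonoidHom.ker = E.geom := rfl

/-- Membership in `Δ`: `x ∈ Δ ↔ aug x = 1`. [cite: MochizukiAbsTopIII2015, Thm 1.9 p.37] -/
@[simp] theorem mem_geom {x : E.arith} : x ∈ E.geom ↔ E.aug x = 1 := Iff.rfl

/-- `Δ` is normal in `Π` (it is a kernel). [cite: MochizukiAbsTopIII2015, Thm 1.9 p.37] -/
instance normal_geom : E.geom.Normal := inferInstanceAs E.aug.toMonoidHom.ker.Normal

/-- `Δ` is closed in `Π` (`G` is Hausdorff and `aug` is continuous).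
[cite: MochizukiAbsTopIII2015, Thm 1.9 p.37] -/
theorem isClosed_geom : IsClosed (E.geom : Set E.arith) := by
  have h : (E.geom : Set E.arith) = E.aug ⁻¹' {1} := by
    ext x
    simp [mem_geom]
  rw [h]
  exact isClosed_singleton.preimage (map_continuous E.aug)

/-- `Δ` as a closed subgroup of `Π`. [cite: MochizukiAbsTopIII2015, Thm 1.9 p.37] -/
def geomClosed : ClosedSubgroup E.arith := { E.geom with isClosed' := E.isClosed_geom }

/-- `Δ` as a profinite group in its own right. [cite: MochizukiAbsTopIII2015, Thm 1.9 p.37] -/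
noncomputable def geomGrp : ProfiniteGrp.{u} := ProfiniteGrp.ofClosedSubgroup E.geomClosed

/-- `Π/Δ ≃ G` as abstract groups: the extension is exact at `G` because `aug` is surjective.
[cite: MochizukiAbsTopIII2015, Thm 1.9 p.37] -/
noncomputable def quotientGeomEquivGal : E.arith ⧸ E.geom ≃* E.gal :=
  QuotientGroup.quotientKerEquivOfSurjective E.aug.toMonoidHom E.aug_surjective

/-! ### Morphisms of extensions -/

/-- A *homomorphism of extensions of profinite groups* `E → F` ([AbsTopIII] Thm 1.9 p. 38, final
paragraph: functoriality "with respect to arbitrary open injective homomorphisms of extensions of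
profinite groups [...] as well as with respect to homomorphisms of extensions of profinite groups
arising from a base-change of the base field"): continuous homomorphisms `Π_E → Π_F`, `G_E → G_F`
compatible with the augmentations (hence mapping `Δ_E` into `Δ_F`, `Hom.mapsTo_geom`).
[cite: MochizukiAbsTopIII2015, Thm 1.9 p.38] -/
@[ext] structure Hom (E F : FundamentalExtension.{u}) : Type u where
  /-- the component on `Π` -/
  arith : E.arith →ₜ* F.arith
  /-- the component on `G` -/
  gal : E.gal →ₜ* F.gal
  /-- the square with the augmentations commutes -/
  comm : ∀ x, F.aug (arith x) = gal (E.aug x)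

/-- Extensions of profinite groups and their homomorphisms form a category.
[cite: MochizukiAbsTopIII2015, Thm 1.9 p.38] -/
instance : Category.{u} FundamentalExtension.{u} where
  Hom := Hom
  id E := ⟨ContinuousMonoidHom.id _, ContinuousMonoidHom.id _, fun _ => rfl⟩
  comp f g := ⟨g.arith.comp f.arith, g.gal.comp f.gal, fun x => by
    change _ = g.gal (f.gal _)
    rw [← f.comm, ← g.comm]
    rfl⟩
  id_comp f := Hom.ext (ContinuousMonoidHom.ext fun _ => rfl) (ContinuousMonoidHom.ext fun _ => rfl)
  comp_id f := Hom.ext (ContinuousMonoidHom.ext fun _ => rfl) (ContinuousMonoidHom.ext fun _ => rfl)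
  assoc f g h :=
    Hom.ext (ContinuousMonoidHom.ext fun _ => rfl) (ContinuousMonoidHom.ext fun _ => rfl)

variable {E} {F : FundamentalExtension.{u}}

/-- The `Π`-component of the identity. [cite: MochizukiAbsTopIII2015, Thm 1.9 p.38] -/
@[simp] theorem id_arith : Hom.arith (𝟙 E) = ContinuousMonoidHom.id _ := rfl

/-- The `G`-component of the identity. [cite: MochizukiAbsTopIII2015, Thm 1.9 p.38] -/
@[simp] theorem id_gal : Hom.gal (𝟙 E) = ContinuousMonoidHom.id _ := rfl

/-- The `Π`-component of a composite. [cite: MochizukiAbsTopIII2015, Thm 1.9 p.38] -/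
@[simp] theorem comp_arith {E F K : FundamentalExtension.{u}} (f : E ⟶ F) (g : F ⟶ K) :
    (f ≫ g).arith = g.arith.comp f.arith := rfl

/-- The `G`-component of a composite. [cite: MochizukiAbsTopIII2015, Thm 1.9 p.38] -/
@[simp] theorem comp_gal {E F K : FundamentalExtension.{u}} (f : E ⟶ F) (g : F ⟶ K) :
    (f ≫ g).gal = g.gal.comp f.gal := rfl

/-- A homomorphism of extensions maps `Δ_E` into `Δ_F`.
[cite: MochizukiAbsTopIII2015, Thm 1.9 p.38] -/
theorem Hom.mapsTo_geom (f : E ⟶ F) : Set.MapsTo f.arith E.geom F.geom := by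
  intro x hx
  have hx' : E.aug x = 1 := hx
  change F.aug (f.arith x) = 1
  rw [f.comm, hx', map_one]

/-- `Δ_E ≤ f⁻¹(Δ_F)` as subgroups. [cite: MochizukiAbsTopIII2015, Thm 1.9 p.38] -/
theorem Hom.geom_le_comap (f : E ⟶ F) : E.geom ≤ F.geom.comap f.arith.toMonoidHom :=
  fun _ hx => f.mapsTo_geom hx

/-- An *open injective homomorphism of extensions of profinite groups* ([AbsTopIII] Thm 1.9 p. 38,
Cor 1.10 pp. 42, 44, Thm 1.11 p. 47: the functoriality asserted for the reconstruction
algorithms): both components are injective with open image, i.e. isomorphisms onto open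
subgroups. [cite: MochizukiAbsTopIII2015, Thm 1.9 p.38] -/
@[mk_iff] structure Hom.IsOpenInjective (f : E ⟶ F) : Prop where
  /-- `Π_E → Π_F` is injective -/
  arith_injective : Function.Injective f.arith
  /-- with open image -/
  isOpen_range_arith : IsOpen (Set.range f.arith)
  /-- `G_E → G_F` is injective -/
  gal_injective : Function.Injective f.gal
  /-- with open image -/
  isOpen_range_gal : IsOpen (Set.range f.gal)

/-- A homomorphism of extensions *arising from a base-change of the base field* ([AbsTopIII]
Thm 1.9 p. 38; e.g. `k ⊆ k'`, `Π_{X_{k'}} = Π_X ×_{G_k} G_{k'} → Π_X`), typed by its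
group-theoretic shadow: the `Π`-component maps `Δ_E` bijectively onto `Δ_F` (so the square is
cartesian).  No injectivity of the `G`-component is required (completions `k ⊆ k_v` are allowed,
cf. Rmk 1.9.5 (ii) p. 39). [cite: MochizukiAbsTopIII2015, Thm 1.9 p.38] -/
@[mk_iff] structure Hom.IsBaseChange (f : E ⟶ F) : Prop where
  /-- `Δ_E → Δ_F` is a bijection -/
  bijOn_geom : Set.BijOn f.arith E.geom F.geom

/-- The identity is an open injective homomorphism of extensions.
[cite: MochizukiAbsTopIII2015, Thm 1.9 p.38] -/
theorem Hom.IsOpenInjective.id (E : FundamentalExtension.{u}) : Hom.IsOpenInjective (𝟙 E) where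
  arith_injective := fun _ _ h => h
  isOpen_range_arith := by
    rw [show Set.range (Hom.arith (𝟙 E)) = Set.univ from Set.range_eq_univ.mpr fun x => ⟨x, rfl⟩]
    exact isOpen_univ
  gal_injective := fun _ _ h => h
  isOpen_range_gal := by
    rw [show Set.range (Hom.gal (𝟙 E)) = Set.univ from Set.range_eq_univ.mpr fun x => ⟨x, rfl⟩]
    exact isOpen_univ

/-- The identity arises from the trivial base-change. [cite: MochizukiAbsTopIII2015, Thm 1.9 p.38] -/
theorem Hom.IsBaseChange.id (E : FundamentalExtension.{u}) : Hom.IsBaseChange (𝟙 E) where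
  bijOn_geom := Set.bijOn_id _

/-! ### Procyclic groups "`≅ Ẑ`" -/

/-- A topological group is *free procyclic*, i.e. isomorphic to `Ẑ` = "the profinite completion
of the group `ℤ`" ([AbsTopI] §0 p. 7), iff (for a profinite group) it is topologically generated
by one element and has an open subgroup of every positive index.  This is the group-theoretic
content of "the inertia group `I_x` [...] is naturally isomorphic to `Ẑ(1)`" ([AbsTopIII]
Prop 1.4 (i) p. 31) once the Galois action is forgotten. [cite: MochizukiAbsTopIII2015, Prop 1.4 (i) p.31] -/
@[mk_iff] structure IsFreeProcyclic (G : Type u) [Group G] [TopologicalSpace G] : Prop where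
  /-- some cyclic subgroup is dense -/
  exists_dense_zpowers : ∃ g : G, Dense (Subgroup.zpowers g : Set G)
  /-- there is an open subgroup of each positive index -/
  exists_isOpen_index : ∀ n : ℕ, 0 < n → ∃ H : Subgroup G, IsOpen (H : Set G) ∧ H.index = n

/-! ### Cusps: decomposition and inertia groups -/

/-- *Cuspidal data* on an extension `E`: an index set of cusps and, for each cusp `x`, a chosen
decomposition group `D_x ⊆ Π` — well-defined only up to `Π`-conjugacy, which is why distinct
cusps are required to have non-conjugate decomposition groups (`eq_of_conj`) and all invariant
notions below are conjugation-stable — with inertia group `I_x = D_x ∩ Δ` ([AbsTopIII] Prop 1.4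
(i) p. 31 "the inertia group `I_x` of `x` in `Δ_U`"; Thm 1.9 (a) p. 37 "`Π_U` equipped with the
collection of subgroups that arise as decomposition groups"; Thm 1.11 (b) p. 46 "the
decomposition group `D_x ⊆ Π_{η_X}` [...] the normalizer [...] of `I_x`").
[cite: MochizukiAbsTopIII2015, Prop 1.4 (i) p.31] -/
structure CuspidalData (E : FundamentalExtension.{u}) : Type (u + 1) where
  /-- the index set of cusps -/
  Cusp : Type u
  /-- there are finitely many cusps -/
  [finite : Finite Cusp]
  /-- a decomposition group `D_x ⊆ Π` of the cusp `x` (a representative of its conjugacy class) -/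
  Dcusp : Cusp → Subgroup E.arith
  /-- the inertia group `I_x ⊆ Π` of the cusp `x` -/
  Icusp : Cusp → Subgroup E.arith
  /-- `I_x = D_x ∩ Δ` -/
  Icusp_eq : ∀ x, Icusp x = Dcusp x ⊓ E.geom
  /-- decomposition groups are closed -/
  isClosed_Dcusp : ∀ x, IsClosed (Dcusp x : Set E.arith)
  /-- distinct cusps have non-conjugate decomposition groups -/
  eq_of_conj : ∀ x y (g : E.arith), MulAut.conj g • Dcusp x = Dcusp y → x = y

namespace CuspidalData

variable {E : FundamentalExtension.{u}}

/-- The index set of cusps is finite. [cite: MochizukiAbsTopIII2015, Prop 1.4 (i) p.31] -/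
instance finite_Cusp (C : CuspidalData E) : Finite C.Cusp := C.finite

/-- `I_x ≤ Δ`. [cite: MochizukiAbsTopIII2015, Prop 1.4 (i) p.31] -/
theorem Icusp_le_geom (C : CuspidalData E) (x : C.Cusp) : C.Icusp x ≤ E.geom := by
  rw [C.Icusp_eq]
  exact inf_le_right

/-- `I_x ≤ D_x`. [cite: MochizukiAbsTopIII2015, Prop 1.4 (i) p.31] -/
theorem Icusp_le_Dcusp (C : CuspidalData E) (x : C.Cusp) : C.Icusp x ≤ C.Dcusp x := by
  rw [C.Icusp_eq]
  exact inf_le_left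

/-- Inertia groups are closed (`D_x` and `Δ` are). [cite: MochizukiAbsTopIII2015, Prop 1.4 (i) p.31] -/
theorem isClosed_Icusp (C : CuspidalData E) (x : C.Cusp) : IsClosed (C.Icusp x : Set E.arith) := by
  rw [C.Icusp_eq, Subgroup.coe_inf]
  exact (C.isClosed_Dcusp x).inter E.isClosed_geom

/-- The conjugacy class of decomposition groups of a cusp (the invariant datum).
[cite: MochizukiAbsTopIII2015, Thm 1.9 (a) p.37] -/
def decompositionClass (C : CuspidalData E) (x : C.Cusp) : Set (Subgroup E.arith) :=
  {D | ∃ g : E.arith, D = MulAut.conj g • C.Dcusp x}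

/-- The chosen representative lies in its class. [cite: MochizukiAbsTopIII2015, Thm 1.9 (a) p.37] -/
theorem Dcusp_mem_decompositionClass (C : CuspidalData E) (x : C.Cusp) : C.Dcusp x ∈ C.decompositionClass x :=
  ⟨1, by simp⟩

/-- Cusps are recovered from their conjugacy classes of decomposition groups: the assignment
`x ↦ decompositionClass x` is injective. [cite: MochizukiAbsTopIII2015, Thm 1.9 (a) p.37] -/
theorem decompositionClass_injective (C : CuspidalData E) :
    Function.Injective C.decompositionClass := by
  intro x y hxy
  have hx : C.Dcusp y ∈ C.decompositionClass x := hxy ▸ C.Dcusp_mem_decompositionClass y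
  obtain ⟨g, hg⟩ := hx
  exact C.eq_of_conj x y g hg.symm

/-- A cusp is *rational* (over the base field) when its decomposition group surjects onto `G`
([AbsTopIII] Prop 1.6 (ii) p. 35: for `x ∈ X(k)` the section `s_x : G_k → Π_X`).
[cite: MochizukiAbsTopIII2015, Prop 1.6 (ii) p.35] -/
def IsRational (C : CuspidalData E) (x : C.Cusp) : Prop := Set.SurjOn E.aug (C.Dcusp x) Set.univ

/-- "each of which is naturally isomorphic to `Ẑ(1)`" ([AbsTopIII] Prop 1.4 (i) p. 31), as a
property of cuspidal data with the Galois action forgotten: every inertia group is free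
procyclic. [cite: MochizukiAbsTopIII2015, Prop 1.4 (i) p.31] -/
def InertiaFreeProcyclic (C : CuspidalData E) : Prop := ∀ x : C.Cusp, IsFreeProcyclic (C.Icusp x)

/-- "the decomposition group `D_x` [...] may then be constructed as the normalizer [...] of `I_x`"
([AbsTopIII] Thm 1.11 (b) p. 46), as a property of cuspidal data.
[cite: MochizukiAbsTopIII2015, Thm 1.11 (b) p.46] -/
def DecompEqNormalizer (C : CuspidalData E) : Prop :=
  ∀ x : C.Cusp, C.Dcusp x = Subgroup.normalizer (C.Icusp x : Set E.arith)

end CuspidalData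

end FundamentalExtension

end Literature.AnabelianGeometry.AbsoluteAnabelian
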